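import Summits.QuantumFields.YangMills.Theorems.LuscherReductionTwistedTraceScalingBOStiffKinDefectLinear
import Summits.QuantumFields.YangMills.Theorems.LuscherReductionTwistedTraceScalingBOStiffCentralData
import Summits.QuantumFields.YangMills.Theorems.LuscherReductionTwistedTraceScalingFPWeightIntegrand
import Summits.QuantumFields.YangMills.Theorems.LuscherReductionTwistedTraceScalingFPWeightGaussianValue
import Summits.QuantumFields.YangMills.Theorems.LuscherReductionTwistedTraceScalingLaplaceSandwich
import HarnessLib

/-!
# (B-ST) atom (B4a), part 2: THE BASED CENTRAL KERNEL IS BOUNDED BELOW BY THE FLAT GAUSSIAN — at fixed `β`, with explicit constants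
# (lane A of S-BASE, crux `TwistedTraceScaling` stmt-QuantumFields-20203, C4-CORE, the (B-ST) pen; `pub/ym-fleet/ym-luscher-20007-p1/HANDOFF-g22.md` §DESIGN 1–2)

`cM β x x' = ∫ K_β(orthoTube 1 x, (orthoTube 1 x')^{basedExt h}) dh` (`…BOStiffDefs`).  By ✓`transferKernel_gaugeTransform_eq` the integrand is
`exp(β(2|E| − kinDefect) − (β/2)(S+S'))`, and by ✓`…BOStiffKinDefectLinear.kinDefect_central_based_le` the defect at the based chart copy `h = basedExt(gno∘w)` is
`≤ ‖x̂ − x̂' + ∇(flatLin w)‖² + 201|E|τ³`.  Restrict the based Haar integral to the chart image of the flat ball `B = {‖w − w₁‖∞ ≤ ρ_h}` centred at a `w₁` with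
`x̂ − x̂' + ∇(flatLin w₁) = v ⊥ Γ` (the gauge mismatch of the pair is absorbed by the centre of the ball — this is why the lower bound has FULL REACH in the gauge directions),
pass to flat coordinates with the lower Haar sandwich ✓`integral_pi_haar_ge_gaussian`, use Pythagoras `‖v + ∇flatLin(w−w₁)‖² = ‖v‖² + ‖∇flatLin(w−w₁)‖²`, translate `w ↦ w − w₁`
(Lebesgue), and evaluate the censored flat Gaussian from below by ✓`laplace_sandwich` (η = 0) and ✓`laplaceIntegral_eq` at the vacuum base point:
★★★ `cM_ge_flat_gaussian` —
  `cM β x x' ≥ e^{β·2|E| − (β/2)(S(oT1x)+S(oT1x'))} · (2π²)^{-n} · e^{−6n(‖w₁‖+ρ_h)²} · e^{−201β|E|τ³} · e^{−β‖v‖²} · ((π/β)^{d/2} − e^{−c_L²ρ_h²β/2}(2π/β)^{d/2})/√(gramDet 0)`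
for `β > 0`, `x, x'` on the cap, `√2‖x̂‖, √2‖x̂'‖ ≤ τ`, `√3(‖w₁‖+ρ_h) ≤ τ ≤ 1`, `c_L = (2·sliceConst L)⁻¹` (`n = |NzSite|`, `d = flatDim`).  No `∀ᶠ`: the schedule (`τ, ρ_h = O(β^{-1/2}ℓ)`)
and the conversion of the constant to `e^{2β|E|}·fpWeightBar L (powScale (1/2) β)` are the next file (`…BOStiffCentralLower`).
HONEST FRAMING: measure bookkeeping + Laplace lower bound for a stub of a child of the CONDITIONAL route R2b1; (B-ST) OPEN; C4-CORE OPEN; not infinite volume, not a gap, not Clay.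
-/

set_option autoImplicit false

noncomputable section

open MeasureTheory Filter Topology Real
open scoped BigOperators Matrix Quaternion RealInnerProductSpace
open Literature.MathematicalPhysics.QuantumFieldTheory
open Literature.MathematicalPhysics.QuantumLattice

namespace Summit.QuantumFields.YangMills.Theorems.FemtoTransferGap.TwoLattice.ConstTube

open Summit.QuantumFields.YangMills.Theorems.FemtoTransferGap
open Summit.QuantumFields.YangMills.Theorems.FemtoTransferGap.TwoLattice
open Summit.QuantumFields.YangMills.Theorems.FemtoTransferGap.TwoLattice.Avg
open Summit.QuantumFields.YangMills.Theorems.FemtoTransferGap.TwoLattice.Stiff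
open Summit.QuantumFields.YangMills.Theorems.FemtoTransferGap.TwoLattice.GnChart
open Summit.QuantumFields.YangMills.Theorems.FemtoTransferGap.TwoLattice.Cov (scalarPart_inv vecPart_inv)
open Literature.MathematicalPhysics.QuantumFieldTheory.Balaban1983to89.T4CubeChartGnomonic (gnoPoint)

variable {L : ℕ} [NeZero L]

/-! ## §1 The integrand of `cM` against the kinetic defect; measurability -/

/-- The `cM` integrand, exactly: `K_β(U, V^{basedExt h}) = e^{β·2|E| − (β/2)(S U + S V)} · e^{−β·kinDefect U V (basedExt h)}`. [cite: Luscher1983, §3] -/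
theorem transferKernel_basedExt_eq (β : ℝ) (U V : GaugeConfig 3 L SU2) (h : NzSite L → SU2) :
    transferKernel su2Rep β U (gaugeTransform (basedExt L h) V) =
      Real.exp (β * (2 * (Fintype.card (Edge 3 L) : ℝ)) - β / 2 * (wilsonAction su2Rep U + wilsonAction su2Rep V)) *
        Real.exp (-(β * kinDefect L U V (basedExt L h))) := by
  rw [transferKernel_gaugeTransform_eq, ← Real.exp_add]; congr 1; ring

/-- `h ↦ K_β(U, V^{basedExt h})` is measurable. [folklore] -/
theorem measurable_transferKernel_basedExt (β : ℝ) (U V : GaugeConfig 3 L SU2) :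
    Measurable fun h : NzSite L → SU2 => transferKernel su2Rep β U (gaugeTransform (basedExt L h) V) := by
  have hK : Measurable fun q : GaugeConfig 3 L SU2 × GaugeConfig 3 L SU2 => transferKernel su2Rep β q.1 q.2 :=
    (continuous_transferKernel su2Rep continuous_su2Rep β).measurable
  have h2 : Measurable fun h : NzSite L → SU2 => gaugeTransform (basedExt L h) V := by
    have h := (measurable_gaugeAction (L := L)).comp (measurable_const.prodMk (measurable_basedExt L) : Measurable fun h : NzSite L → SU2 => (V, basedExt L h))
    simpa only [Function.comp_def] using h
  have h := hK.comp (measurable_const.prodMk h2 : Measurable fun h : NzSite L → SU2 => (U, gaugeTransform (basedExt L h) V))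
  simpa only [Function.comp_def] using h

omit [NeZero L] in
/-- The gnomonic coordinates of a based field, `h ↦ (y ↦ gnLink (h y))`, are measurable. [folklore] -/
theorem measurable_gnLink_pi : Measurable fun h : NzSite L → SU2 => fun y => gnLink (h y) :=
  measurable_pi_lambda _ fun y => measurable_pi_lambda _ fun a => (measurable_gnLink_apply a).comp (measurable_pi_apply y)

/-- The set of based fields with every factor in the open upper hemisphere is measurable. [folklore] -/
theorem measurableSet_upper : MeasurableSet {h : NzSite L → SU2 | ∀ y, 0 < scalarPart (h y)} := by
  have e : {h : NzSite L → SU2 | ∀ y, 0 < scalarPart (h y)} = ⋂ y, (fun h : NzSite L → SU2 => scalarPart (h y)) ⁻¹' Set.Ioi 0 := by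
    ext h; simp
  rw [e]
  exact MeasurableSet.iInter fun y => (continuous_scalarPart.measurable.comp (measurable_pi_apply y)) measurableSet_Ioi

/-! ## §2 Flat-side pointwise facts -/

/-- `laplaceMap L 0 w = −∇(flatLin w)`, hence `‖laplaceMap L 0 w‖ = ‖∇(flatLin w)‖`. [folklore] -/
theorem norm_laplaceMap_zero (w : NzSite L → Fin 3 → ℝ) : ‖laplaceMap L 0 w‖ = ‖vacGrad L (flatLin L w : Site 3 L → Fin 3 → ℝ)‖ := by
  have hm : vacGrad L (flatLin L w : Site 3 L → Fin 3 → ℝ) ∈ gaugeModes L := LinearMap.mem_range_self _ _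
  rw [laplaceMap_apply, basedLin_zero, map_neg, (Submodule.starProjection_eq_self_iff).2 hm, norm_neg]

/-- Coercivity at the vacuum base point: `‖w‖∞ ≤ 2·sliceConst·‖laplaceMap L 0 w‖`. [folklore] -/
theorem norm_le_laplaceMap_zero (w : NzSite L → Fin 3 → ℝ) : (2 * sliceConst L)⁻¹ * ‖w‖ ≤ ‖laplaceMap L 0 w‖ := by
  have h := norm_le_basedLin_zero L (flatLin L w)
  rw [norm_flatLin, ← laplaceMap_apply] at h
  have hc : 0 < 2 * sliceConst L := by have := sliceConst_pos L; positivity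
  rw [inv_mul_le_iff₀ hc]; exact h

/-- Pythagoras for the decomposition `x̂ − x̂' + ∇flatLin w = v + ∇flatLin(w − w₁)`, `v ⊥ Γ`. [folklore] -/
theorem norm_sq_split {v : LinkSpace L} (hv : v ∈ (gaugeModes L)ᗮ) (φ : Site 3 L → Fin 3 → ℝ) :
    ‖v + vacGrad L φ‖ ^ 2 = ‖v‖ ^ 2 + ‖vacGrad L φ‖ ^ 2 := by
  have hm : vacGrad L φ ∈ gaugeModes L := LinearMap.mem_range_self _ _
  have h0 : ⟪v, vacGrad L φ⟫ = 0 := by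
    rw [real_inner_comm]; exact (Submodule.mem_orthogonal _ _).1 hv _ hm
  have h := norm_add_sq_eq_norm_sq_add_norm_sq_of_inner_eq_zero v (vacGrad L φ) h0
  simpa [sq] using h

/-! ## §3 ★★★ The flat Gaussian lower bound -/

set_option maxHeartbeats 1600000 in
-- long chain of integral comparisons.
/-- ★★★ **THE BASED CENTRAL KERNEL IS BOUNDED BELOW BY THE FLAT GAUSSIAN** (see the module docstring). [cite: Luscher1983, §3] [cite: SjostrandZworski2007, §2] -/
theorem cM_ge_flat_gaussian (hL : Nonempty (NzSite L)) {β : ℝ} (hβ : 0 < β) {x x' : Edge 3 L → Fin 3 → ℝ}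
    (hx : ∀ e, ∑ a, x e a ^ 2 ≤ 1) (hx' : ∀ e, ∑ a, x' e a ^ 2 ≤ 1) (w₁ : NzSite L → Fin 3 → ℝ) {v : LinkSpace L} (hv : v ∈ (gaugeModes L)ᗮ)
    (hw₁ : linkEmbed L (x - x') + vacGrad L (flatLin L w₁ : Site 3 L → Fin 3 → ℝ) = v) {τ ρh : ℝ} (hρh : 0 < ρh) (hτ1 : τ ≤ 1)
    (hτx : Real.sqrt 2 * ‖linkEmbed L x‖ ≤ τ) (hτx' : Real.sqrt 2 * ‖linkEmbed L x'‖ ≤ τ) (hτw : Real.sqrt 3 * (‖w₁‖ + ρh) ≤ τ) :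
    Real.exp (β * (2 * (Fintype.card (Edge 3 L) : ℝ)) - β / 2 * (wilsonAction su2Rep (orthoTube L 1 x) + wilsonAction su2Rep (orthoTube L 1 x'))) *
        (((2 * π ^ 2)⁻¹) ^ Fintype.card (NzSite L) *
          (Real.exp (-(6 * Fintype.card (NzSite L) * (‖w₁‖ + ρh) ^ 2)) * Real.exp (-(β * (201 * Fintype.card (Edge 3 L) * τ ^ 3))) *
            Real.exp (-(β * ‖v‖ ^ 2)) *
            (((π * β⁻¹) ^ (flatDim L / 2 : ℝ) - Real.exp (-((2 * sliceConst L)⁻¹ ^ 2 * ρh ^ 2 * β / 2)) * (2 * (π * β⁻¹)) ^ (flatDim L / 2 : ℝ)) /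
              Real.sqrt (gramDet L 0)))) ≤
      cM L β x x' := by
  classical
  -- names
  set U := orthoTube L 1 x with hU
  set V := orthoTube L 1 x' with hV
  set nE : ℝ := (Fintype.card (Edge 3 L) : ℝ) with hnE
  set n : ℕ := Fintype.card (NzSite L) with hn
  set Cmag := Real.exp (β * (2 * nE) - β / 2 * (wilsonAction su2Rep U + wilsonAction su2Rep V)) with hCmag
  have hCmag0 : 0 < Cmag := Real.exp_pos _
  set R := ‖w₁‖ + ρh with hR
  have hR0 : 0 ≤ R := by positivity
  have hτ0 : 0 ≤ τ := le_trans (by positivity) hτw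
  -- the integrand and its restriction
  set F : (NzSite L → SU2) → ℝ := fun h => transferKernel su2Rep β U (gaugeTransform (basedExt L h) V) with hFdef
  have hF : ∀ h, F h = Cmag * Real.exp (-(β * kinDefect L U V (basedExt L h))) := fun h => transferKernel_basedExt_eq β U V h
  have hFm : Measurable F := measurable_transferKernel_basedExt β U V
  have hF0 : ∀ h, 0 ≤ F h := fun h => by rw [hF h]; positivity
  have hFle : ∀ h, F h ≤ Cmag := fun h => by
    rw [hF h]
    have : Real.exp (-(β * kinDefect L U V (basedExt L h))) ≤ 1 := Real.exp_le_one_iff.2 (by have := kinDefect_nonneg (L := L) U V (basedExt L h); nlinarith)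
    nlinarith
  set T : Set (NzSite L → SU2) := {h | ∀ y, 0 < scalarPart (h y)} ∩ {h | ‖(fun y => gnLink (h y)) - w₁‖ ≤ ρh} with hT
  have hTm : MeasurableSet T := by
    refine measurableSet_upper.inter ?_
    have e : {h : NzSite L → SU2 | ‖(fun y => gnLink (h y)) - w₁‖ ≤ ρh} = (fun h : NzSite L → SU2 => fun y => gnLink (h y)) ⁻¹' Metric.closedBall w₁ ρh := by
      ext h; simp [dist_eq_norm]
    rw [e]; exact measurable_gnLink_pi measurableSet_closedBall
  set g : (NzSite L → SU2) → ℝ := T.indicator F with hg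
  have hgm : Measurable g := hFm.indicator hTm
  have hg0 : ∀ h, 0 ≤ g h := fun h => Set.indicator_nonneg (fun h _ => hF0 h) h
  have hgF : ∀ h, g h ≤ F h := fun h => Set.indicator_le_self' (fun h _ => hF0 h) h
  have hgb : ∃ C : ℝ, ∀ h, |g h| ≤ C := ⟨Cmag, fun h => by rw [abs_of_nonneg (hg0 h)]; exact (hgF h).trans (hFle h)⟩
  have hg00 : ∀ W : NzSite L → SU2, (∃ i, scalarPart (W i) ≤ 0) → g W = 0 := fun W ⟨i, hi⟩ => by
    rw [hg, Set.indicator_of_notMem]; rintro ⟨h1, -⟩; exact absurd (h1 i) (not_lt.2 hi)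
  -- step 1: cM = ∫ F ≥ ∫ g
  haveI : IsProbabilityMeasure (basedMeasure L) := by unfold basedMeasure; infer_instance
  have hFint : Integrable F (basedMeasure L) :=
    integrable_of_measurable_abs_le (basedMeasure L) hFm (C := Cmag) fun h => by rw [abs_of_nonneg (hF0 h)]; exact hFle h
  have h1 : ∫ h, g h ∂basedMeasure L ≤ cM L β x x' := by
    have : cM L β x x' = ∫ h, F h ∂basedMeasure L := rfl
    rw [this]; exact integral_mono_of_nonneg (ae_of_all _ hg0) hFint (ae_of_all _ hgF)
  -- step 2: Haar lower sandwich
  have h2 := integral_pi_haar_ge_gaussian (ι := NzSite L) hgm hgb hg0 hg00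
  -- step 3: the chart pull-back of g, pointwise from below on the ball
  set C₁ := Cmag * (Real.exp (-(6 * n * R ^ 2)) * Real.exp (-(β * (201 * nE * τ ^ 3))) * Real.exp (-(β * ‖v‖ ^ 2))) with hC₁
  have hC₁0 : 0 < C₁ := by positivity
  set φ : (NzSite L → Fin 3 → ℝ) → ℝ := fun w' => if ‖w'‖ ≤ ρh then C₁ * Real.exp (-(β * ‖vacGrad L (flatLin L w' : Site 3 L → Fin 3 → ℝ)‖ ^ 2)) else 0 with hφ
  have hchart : ∀ w : NzSite L → Fin 3 → ℝ,
      φ (w - w₁) ≤ g (piPatternChart (NzSite L) (fun _ => false) w) * Real.exp (-(2 * ∑ i, ∑ a, w i a ^ 2)) := by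
    intro w
    have hpc : piPatternChart (NzSite L) (fun _ => false) w = fun y => gnoPoint (w y) := funext fun y => piPatternChart_false _ w y
    by_cases hw : ‖w - w₁‖ ≤ ρh
    · -- inside the ball
      have hmem : (fun y => gnoPoint (w y)) ∈ T := by
        refine ⟨fun y => scalarPart_gnoPoint_pos (w y), ?_⟩
        show ‖(fun y => gnLink (gnoPoint (w y))) - w₁‖ ≤ ρh
        have : (fun y => gnLink (gnoPoint (w y))) = w := funext fun y => gnLink_gnoPoint (w y)
        rw [this]; exact hw
      rw [hpc, hg, Set.indicator_of_mem hmem, hF]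
      have hφw : φ (w - w₁) = C₁ * Real.exp (-(β * ‖vacGrad L (flatLin L (w - w₁) : Site 3 L → Fin 3 → ℝ)‖ ^ 2)) := by rw [hφ]; simp [hw]
      rw [hφw]
      -- sizes
      have hwR : ‖w‖ ≤ R := by
        calc ‖w‖ = ‖(w - w₁) + w₁‖ := by rw [sub_add_cancel]
          _ ≤ ‖w - w₁‖ + ‖w₁‖ := norm_add_le _ _
          _ ≤ R := by rw [hR]; linarith
      have hτw' : Real.sqrt 3 * ‖w‖ ≤ τ := le_trans (mul_le_mul_of_nonneg_left hwR (Real.sqrt_nonneg 3)) hτw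
      have hkd := kinDefect_central_based_le (L := L) hx hx' w hτ1 hτx hτx' hτw'
      have hsplit : linkEmbed L (x - x') + vacGrad L (flatLin L w : Site 3 L → Fin 3 → ℝ) = v + vacGrad L (flatLin L (w - w₁) : Site 3 L → Fin 3 → ℝ) := by
        rw [← hw₁, (flatLin L).map_sub, Submodule.coe_sub, (vacGrad L).map_sub]; abel
      rw [hsplit, norm_sq_split hv] at hkd
      have hgauss : Real.exp (-(6 * n * R ^ 2)) ≤ Real.exp (-(2 * ∑ i, ∑ a, w i a ^ 2)) := by
        refine Real.exp_le_exp.2 (neg_le_neg ?_)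
        have h := sum_sum_sq_le w
        have hw2 : ‖w‖ ^ 2 ≤ R ^ 2 := pow_le_pow_left₀ (norm_nonneg _) hwR 2
        rw [← hn] at h
        nlinarith [mul_le_mul_of_nonneg_left hw2 (by positivity : (0 : ℝ) ≤ 3 * n)]
      have hexp : Real.exp (-(β * (201 * nE * τ ^ 3))) * Real.exp (-(β * ‖v‖ ^ 2)) * Real.exp (-(β * ‖vacGrad L (flatLin L (w - w₁) : Site 3 L → Fin 3 → ℝ)‖ ^ 2)) ≤
          Real.exp (-(β * kinDefect L U V (basedExt L fun y => gnoPoint (w y)))) := by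
        rw [← Real.exp_add, ← Real.exp_add]
        refine Real.exp_le_exp.2 ?_
        have := mul_le_mul_of_nonneg_left hkd hβ.le
        rw [hnE]; nlinarith
      calc C₁ * Real.exp (-(β * ‖vacGrad L (flatLin L (w - w₁) : Site 3 L → Fin 3 → ℝ)‖ ^ 2))
          = Cmag * (Real.exp (-(β * (201 * nE * τ ^ 3))) * Real.exp (-(β * ‖v‖ ^ 2)) * Real.exp (-(β * ‖vacGrad L (flatLin L (w - w₁) : Site 3 L → Fin 3 → ℝ)‖ ^ 2))) *
              Real.exp (-(6 * n * R ^ 2)) := by rw [hC₁]; ring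
        _ ≤ Cmag * Real.exp (-(β * kinDefect L U V (basedExt L fun y => gnoPoint (w y)))) * Real.exp (-(2 * ∑ i, ∑ a, w i a ^ 2)) := by
            have := mul_le_mul hexp hgauss (Real.exp_pos _).le (Real.exp_pos _).le
            nlinarith [hCmag0, this]
    · -- outside the ball: φ = 0
      have hφw : φ (w - w₁) = 0 := by rw [hφ]; simp [hw]
      rw [hφw]; exact mul_nonneg (hg0 _) (Real.exp_pos _).le
  -- step 4: integrate the pull-back bound
  have hGm : Measurable fun w : NzSite L → Fin 3 → ℝ => g (piPatternChart (NzSite L) (fun _ => false) w) := measurable_comp_vacuumChart (NzSite L) hgm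
  obtain ⟨Cg, hCg⟩ := hgb
  have hint3 : Integrable fun w : NzSite L → Fin 3 → ℝ => g (piPatternChart (NzSite L) (fun _ => false) w) * Real.exp (-(2 * ∑ i, ∑ a, w i a ^ 2)) :=
    integrable_gaussianEnvelope_mul (ι := NzSite L) hGm (C := Cg) fun w => hCg _
  have hφ0 : ∀ w', 0 ≤ φ w' := fun w' => by rw [hφ]; dsimp only; split_ifs <;> positivity
  have h3 : ∫ w, φ (w - w₁) ∂(volume : Measure (NzSite L → Fin 3 → ℝ)) ≤
      ∫ w, g (piPatternChart (NzSite L) (fun _ => false) w) * Real.exp (-(2 * ∑ i, ∑ a, w i a ^ 2)) ∂volume :=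
    integral_mono_of_nonneg (ae_of_all _ fun w => hφ0 _) hint3 (ae_of_all _ hchart)
  -- step 5: translate
  have h4 : ∫ w, φ (w - w₁) ∂(volume : Measure (NzSite L → Fin 3 → ℝ)) = ∫ w, φ w ∂volume := integral_sub_right_eq_self φ w₁
  -- step 6: the censored flat Gaussian from below (Laplace sandwich with η = 0)
  set A := laplaceMap L 0 with hA
  set s : ℝ := (Real.sqrt β)⁻¹ with hs
  have hs0 : 0 < s := by positivity
  have hs2 : s ^ 2 = β⁻¹ := by rw [hs, inv_pow, Real.sq_sqrt hβ.le]
  have hQ : ∀ w : NzSite L → Fin 3 → ℝ, (1 + 0) * ‖A w‖ ^ 2 / s ^ 2 = β * ‖vacGrad L (flatLin L w : Site 3 L → Fin 3 → ℝ)‖ ^ 2 := fun w => by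
    rw [hs2, hA, norm_laplaceMap_zero]; field_simp; ring
  set G : (NzSite L → Fin 3 → ℝ) → ℝ := fun w => if ‖w‖ ≤ ρh then Real.exp (-((1 + 0) * ‖A w‖ ^ 2 / s ^ 2)) else 0 with hGdef
  have hφG : ∀ w, φ w = C₁ * G w := fun w => by
    rw [hφ, hGdef]; simp only
    split_ifs with hw
    · rw [hQ]
    · rw [mul_zero]
  have hc : 0 < (2 * sliceConst L)⁻¹ := by have := sliceConst_pos L; positivity
  have hcoer : ∀ w, (2 * sliceConst L)⁻¹ * ‖w‖ ≤ ‖A w‖ := fun w => by rw [hA]; exact norm_le_laplaceMap_zero w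
  have hGm' : Measurable G := by
    refine Measurable.ite ?_ ((measurable_const.mul ((hA ▸ (laplaceMap L 0).continuous_of_finiteDimensional.measurable.norm).pow_const 2)).div_const _).neg.exp measurable_const
    have e : {w : NzSite L → Fin 3 → ℝ | ‖w‖ ≤ ρh} = Metric.closedBall 0 ρh := by ext w; simp
    rw [e]; exact measurableSet_closedBall
  have hG0 : ∀ w, 0 ≤ G w := fun w => by rw [hGdef]; simp only; split_ifs <;> positivity
  have hcore : ∀ w, ‖w‖ ≤ ρh → Real.exp (-((1 + 0) * ‖A w‖ ^ 2 / s ^ 2)) ≤ G w ∧ G w ≤ Real.exp (-((1 - 0) * ‖A w‖ ^ 2 / s ^ 2)) := fun w hw => by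
    rw [hGdef]; simp only [hw, if_true, add_zero, sub_zero]; exact ⟨le_rfl, le_rfl⟩
  have hoff : ∀ w, ρh < ‖w‖ → G w ≤ Real.exp (-(‖A w‖ ^ 2 / (2 * s ^ 2))) := fun w hw => by
    rw [hGdef]; simp only [not_le.2 hw, if_false]; positivity
  have h5 := (laplace_sandwich (ι := NzSite L) A hc hs0 hρh.le le_rfl (by norm_num : (0 : ℝ) < 1) hcoer hGm' hG0 hcore hoff).1
  -- the Gaussian values at the vacuum base point
  have hI := fun (a : ℝ) (ha : 0 < a) => (laplaceIntegral_eq L).self_of_nhds ha hs0 (a := a)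
  have hI1 : ∫ w, Real.exp (-((1 + 0) * ‖A w‖ ^ 2 / s ^ 2)) ∂(volume : Measure (NzSite L → Fin 3 → ℝ)) =
      (π * β⁻¹) ^ (flatDim L / 2 : ℝ) / Real.sqrt (gramDet L 0) := by
    have h := hI (1 + 0) (by norm_num)
    rw [hA]
    have e : (fun w : NzSite L → Fin 3 → ℝ => Real.exp (-((1 + 0) * ‖laplaceMap L 0 w‖ ^ 2 / s ^ 2))) =
        fun w => Real.exp (-((1 + 0) * ‖laplaceMap L 0 w‖ ^ 2 / s ^ 2)) := rfl
    rw [h, hs2]; norm_num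
  have hI2 : ∫ w, Real.exp (-(1 / 2 * ‖A w‖ ^ 2 / s ^ 2)) ∂(volume : Measure (NzSite L → Fin 3 → ℝ)) =
      (2 * (π * β⁻¹)) ^ (flatDim L / 2 : ℝ) / Real.sqrt (gramDet L 0) := by
    have h := hI (1 / 2) (by norm_num)
    rw [hA, h, hs2]; congr 2; ring
  rw [hI1, hI2] at h5
  -- assemble
  have h6 : ∫ w, φ w ∂(volume : Measure (NzSite L → Fin 3 → ℝ)) = C₁ * ∫ w, G w ∂volume := by
    rw [← integral_const_mul]; exact integral_congr_ae (ae_of_all _ hφG)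
  have htail : (2 * sliceConst L)⁻¹ ^ 2 * ρh ^ 2 / (2 * s ^ 2) = (2 * sliceConst L)⁻¹ ^ 2 * ρh ^ 2 * β / 2 := by rw [hs2]; field_simp
  rw [htail] at h5
  have hpos : (0 : ℝ) ≤ ((2 * π ^ 2)⁻¹) ^ n := by positivity
  calc Cmag * (((2 * π ^ 2)⁻¹) ^ n * (Real.exp (-(6 * n * R ^ 2)) * Real.exp (-(β * (201 * nE * τ ^ 3))) * Real.exp (-(β * ‖v‖ ^ 2)) *
          (((π * β⁻¹) ^ (flatDim L / 2 : ℝ) - Real.exp (-((2 * sliceConst L)⁻¹ ^ 2 * ρh ^ 2 * β / 2)) * (2 * (π * β⁻¹)) ^ (flatDim L / 2 : ℝ)) /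
            Real.sqrt (gramDet L 0))))
      = ((2 * π ^ 2)⁻¹) ^ n * (C₁ * ((π * β⁻¹) ^ (flatDim L / 2 : ℝ) / Real.sqrt (gramDet L 0) -
          Real.exp (-((2 * sliceConst L)⁻¹ ^ 2 * ρh ^ 2 * β / 2)) * ((2 * (π * β⁻¹)) ^ (flatDim L / 2 : ℝ) / Real.sqrt (gramDet L 0)))) := by
        rw [hC₁]; ring
    _ ≤ ((2 * π ^ 2)⁻¹) ^ n * (C₁ * ∫ w, G w ∂volume) := by gcongr
    _ = ((2 * π ^ 2)⁻¹) ^ n * ∫ w, φ (w - w₁) ∂volume := by rw [h4, h6]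
    _ ≤ ((2 * π ^ 2)⁻¹) ^ n * ∫ w, g (piPatternChart (NzSite L) (fun _ => false) w) * Real.exp (-(2 * ∑ i, ∑ a, w i a ^ 2)) ∂volume :=
        mul_le_mul_of_nonneg_left h3 hpos
    _ ≤ ∫ h, g h ∂basedMeasure L := h2
    _ ≤ cM L β x x' := h1

end Summit.QuantumFields.YangMills.Theorems.FemtoTransferGap.TwoLattice.ConstTube

end
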